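import Summits.BirchSwinnertonDyer.BirchSwinnertonDyer.Theorems.EisensteinPrimesBSDpOnCellCTelescopeK2PurityTolerantOfCore
import Summits.BirchSwinnertonDyer.BirchSwinnertonDyer.Theorems.EisensteinPrimesGreenbergCorankAlgebra
import Literature.Algebra.Module.CharacterModuleRankSequences
import Mathlib.LinearAlgebra.Dimension.Localization
import HarnessLib

/-!
# Route `EisensteinPrimes`, crux 4 `BSDpOnCellC` (stmt-BirchSwinnertonDyer-19034), line `telescope`,
# workfile `Lines/telescopeK2weight2.lean` v1.2 sub-leaf W4⁰ (`K2Weight2.stub_bigPseudoNullPTorsion`),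
# route G′ (p^a-cores), input (iii′): **CRK(𝐃, 𝓛') ⟺ CRK(𝐃, 𝓛) for a `c`-ISOGENOUS specification**
# (helper for stmt-BirchSwinnertonDyer-19034; THEOREMS ONLY)

Cell `bsd-eis`, ideator seat `bsd-idea-12` (gen 39), memo `Cruxes/BSDpOnCellC/W-PRICING-n2.md` rev 1.9
§W4-G′. Route G′ replaces Greenberg's specification `𝓛` for the big representation `𝐃` by a CORE
specification `𝓛'` with `c • 𝓛(K_v, 𝐃) ⊆ 𝓛'(K_v, 𝐃) ⊆ 𝓛(K_v, 𝐃)` for every `v ∈ Σ` (`c = p ^ a`;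
`Theorems/EisensteinPrimesBSDpOnCellCTelescopeK2PurityTolerantOfCore.lean` = part 1,
`…PurityCoreAtBadPrimes.lean` = part 2) and then needs Greenberg 2016 Prop. 4.1.1 (c) FOR `𝓛'`, whose
hypothesis CRK(𝐃, 𝓛') must be obtained from the hypothesis CRK(𝐃, 𝓛) the Greenberg-side rows deliver for
`𝓛` (memo rev 1.9, "CRK(𝓛') ⟸ CRK(𝓛): `L_w / p^a L_w` is cotorsion, so the coranks are unchanged").
This file proves exactly that transfer, as generic algebra:

* §1 (Pontryagin-dual ranks under a `c`-isogeny, NO finiteness hypothesis — cardinal `Module.rank`,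
  Mathlib `rank_quotient_add_rank_of_isDomain`): for a domain `Λ` and `c ≠ 0`,
  `rank_characterModule_eq_of_surjective` (`π : A ↠ B` with `c • ker π = 0` ⇒
  `rank_Λ A^∨ = rank_Λ B^∨`), `rank_characterModule_eq_of_injective` (`ι : B ↪ A` with `c • A ⊆ ι(B)` ⇒
  the same), their `finrank` forms, `hasCorank_iff_finrank_characterModule`
  (`HasCorank Λ S r ↔ finrank_Λ S^∨ = r`, from `hasCorank_characterModule` / `hasCorank_unique` of
  `Theorems/EisensteinPrimesGreenbergCorankAlgebra.lean`), and the corank transfers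
  `hasCorank_iff_of_surjective` / `hasCorank_iff_of_injective`. (The tree's
  `Literature.Algebra.Module.finrank_eq_of_exact_of_smul_eq_zero` is the same isogeny statement WITH
  `Module.Finite` on both modules; the corank clause `HasCorank` quantifies over all duals with no
  finiteness available, whence the cardinal version here.)
* §2 (Greenberg's arena): for specifications `𝓛' ≤ 𝓛` on `Σ` with `c • 𝓛 ⊆ 𝓛'` on `Σ`, `c ≠ 0`:
  `finrank_characterModule_selmer_eq_of_core` (`S_{𝓛'} ↪ S_𝓛` with `c • S_𝓛 ⊆ S_{𝓛'}`, part 1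
  `selmer_mono` / `smul_mem_selmer_of_forall`), `finrank_characterModule_QGlobal_eq_of_core`
  (`Q_{𝓛'}(K, 𝐃) ↠ Q_𝓛(K, 𝐃)` componentwise, kernel `∏ 𝓛_v/𝓛'_v` killed by `c`),
  `hasCorank_selmer_iff_of_core`, `hasCorank_QGlobal_iff_of_core`, and
  **`crk_iff_of_core : 𝓛.CRK ↔ 𝓛'.CRK`**, `crk_of_core_pow` (the `c ^ a` shape of parts 1–2).

HONEST FRAMING. Generic algebra (Greenberg 2006 §2 A: `R`-isogenous modules have the same corank);
nothing here proves Prop. 4.1.1, CRK(𝐃, 𝓛) itself, W4⁰, crux 4, or any registered stub; BSD is proved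
for no curve (`--supports`, helper). No `def`, no `instance`, no named fact, no `sorry`. AI-typed,
kernel-checked.

## References
* R. Greenberg, *On the structure of Selmer groups*, in: Elliptic Curves, Modular Forms and Iwasawa
  Theory, Springer Proc. Math. Stat. 188 (2016) 225–252, §2.3 p. 7 L5–17 (coranks, CRK), Remark 3.1.2,
  §4.2 p. 19 L25–31. [Greenberg2016Selmer]
* R. Greenberg, *On the structure of certain Galois cohomology groups*, Doc. Math. Extra Vol. Coates
  (2006) 335–391, §2 A p. 348 L4–9 (`R`-isogenies; kernel/cokernel dual to cokernel/kernel). [Greenberg2006]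
-/

set_option autoImplicit false
set_option linter.dupNamespace false

noncomputable section

open scoped Classical
open NumberField IsDedekindDomain Field
open Literature.NumberTheory.GaloisRepresentations Literature.NumberTheory.IwasawaTheory.Greenberg2016
  Literature.NumberTheory.IwasawaTheory.Greenberg2006

universe u

namespace Summit.BirchSwinnertonDyer.BirchSwinnertonDyer.Theorems.TelescopeK2CoreCRKTransfer

/-! ## §1 Pontryagin-dual ranks and coranks under a `c`-isogeny -/

section Algebra

variable {Λ : Type u} [CommRing Λ] [IsDomain Λ]
  {A : Type u} [AddCommGroup A] [Module Λ A] {B : Type u} [AddCommGroup B] [Module Λ B]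

omit [IsDomain Λ] in
/-- A module killed by a non-zero scalar has (cardinal) rank `0`. [folklore]
[cite: Greenberg2016Selmer, §2.3 p. 7 L5–13] -/
theorem rank_eq_zero_of_forall_smul_eq_zero {N : Type u} [AddCommGroup N] [Module Λ N] {c : Λ}
    (hc : c ≠ 0) (h : ∀ x : N, c • x = 0) : Module.rank Λ N = 0 :=
  rank_eq_zero_iff.mpr fun x ↦ ⟨c, hc, h x⟩

/-- **`rank A^∨ = rank B^∨` for a surjection `π : A ↠ B` whose kernel is killed by `c ≠ 0`**: `π^∨ : B^∨ ↪ A^∨`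
is injective and `A^∨ / π^∨(B^∨) ≅ (ker π)^∨|` is killed by `c` (Pontryagin duality is exact), so has rank
`0`; rank is additive over a domain. No finiteness needed. [cite: Greenberg2006, §2 A p. 348 L4–9] -/
theorem rank_characterModule_eq_of_surjective (π : A →ₗ[Λ] B) (hπ : Function.Surjective π)
    {c : Λ} (hc : c ≠ 0) (hker : ∀ x ∈ LinearMap.ker π, c • x = 0) :
    Module.rank Λ (CharacterModule A) = Module.rank Λ (CharacterModule B) := by
  have hinj : Function.Injective (CharacterModule.dual π) :=
    CharacterModule.dual_injective_of_surjective π hπ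
  have dex := Literature.Algebra.Module.CharacterModule.exact_dual (LinearMap.exact_subtype_ker_map π)
  have h1 := rank_quotient_add_rank_of_isDomain (LinearMap.range (CharacterModule.dual π))
  have hq : Module.rank Λ (CharacterModule A ⧸ LinearMap.range (CharacterModule.dual π)) = 0 := by
    refine rank_eq_zero_of_forall_smul_eq_zero hc fun q ↦ ?_
    obtain ⟨ψ, rfl⟩ := Submodule.mkQ_surjective _ q
    rw [← map_smul, Submodule.mkQ_apply, Submodule.Quotient.mk_eq_zero]
    have h0 : CharacterModule.dual (LinearMap.ker π).subtype (c • ψ) = 0 := by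
      ext x
      change (c • ψ) ((LinearMap.ker π).subtype x) = 0
      rw [CharacterModule.smul_apply, Submodule.subtype_apply, hker x x.2, map_zero]
    obtain ⟨χ, hχ⟩ := (dex _).mp h0
    exact ⟨χ, hχ⟩
  rw [hq, zero_add, ← (LinearEquiv.ofInjective _ hinj).rank_eq] at h1
  exact h1.symm

/-- **`rank A^∨ = rank B^∨` for an injection `ι : B ↪ A` with `c • A ⊆ ι(B)`, `c ≠ 0`**: `ι^∨ : A^∨ ↠ B^∨` is
surjective and its kernel (the characters vanishing on `ι(B) ⊇ c A`) is killed by `c`, so has rank `0`.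
No finiteness needed. [cite: Greenberg2006, §2 A p. 348 L4–9] -/
theorem rank_characterModule_eq_of_injective (ι : B →ₗ[Λ] A) (hι : Function.Injective ι)
    {c : Λ} (hc : c ≠ 0) (hrange : ∀ a : A, c • a ∈ LinearMap.range ι) :
    Module.rank Λ (CharacterModule A) = Module.rank Λ (CharacterModule B) := by
  have hsurj : Function.Surjective (CharacterModule.dual ι) :=
    CharacterModule.dual_surjective_of_injective ι hι
  have h1 := rank_quotient_add_rank_of_isDomain (LinearMap.ker (CharacterModule.dual ι))
  have hk : Module.rank Λ (LinearMap.ker (CharacterModule.dual ι)) = 0 := by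
    refine rank_eq_zero_of_forall_smul_eq_zero hc fun ψ ↦ Subtype.ext ?_
    obtain ⟨ψ, hψ⟩ := ψ
    change c • ψ = 0
    ext a
    obtain ⟨b, hb⟩ := hrange a
    rw [CharacterModule.smul_apply, ← hb]
    change (CharacterModule.dual ι ψ) b = 0
    rw [LinearMap.mem_ker.mp hψ]
    rfl
  rw [hk, add_zero, ((CharacterModule.dual ι).quotKerEquivOfSurjective hsurj).rank_eq] at h1
  exact h1.symm

/-- `finrank` form of `rank_characterModule_eq_of_surjective`. [cite: Greenberg2006, §2 A p. 348 L4–9] -/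
theorem finrank_characterModule_eq_of_surjective (π : A →ₗ[Λ] B) (hπ : Function.Surjective π)
    {c : Λ} (hc : c ≠ 0) (hker : ∀ x ∈ LinearMap.ker π, c • x = 0) :
    Module.finrank Λ (CharacterModule A) = Module.finrank Λ (CharacterModule B) :=
  congrArg Cardinal.toNat (rank_characterModule_eq_of_surjective π hπ hc hker)

/-- `finrank` form of `rank_characterModule_eq_of_injective`. [cite: Greenberg2006, §2 A p. 348 L4–9] -/
theorem finrank_characterModule_eq_of_injective (ι : B →ₗ[Λ] A) (hι : Function.Injective ι)
    {c : Λ} (hc : c ≠ 0) (hrange : ∀ a : A, c • a ∈ LinearMap.range ι) :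
    Module.finrank Λ (CharacterModule A) = Module.finrank Λ (CharacterModule B) :=
  congrArg Cardinal.toNat (rank_characterModule_eq_of_injective ι hι hc hrange)

omit [IsDomain Λ] in
/-- **`corank_Λ S = r` iff the canonical dual `Hom(S, ℚ/ℤ)` has `finrank r`** (coranks are unique and the
canonical datum realises them). [cite: Greenberg2016Selmer, §2.3 p. 7 L5–13] -/
theorem hasCorank_iff_finrank_characterModule {S : Type u} [AddCommGroup S] [Module Λ S] (r : ℕ) :
    HasCorank Λ S r ↔ Module.finrank Λ (CharacterModule S) = r :=
  ⟨fun h ↦ GreenbergFullAtSelmer.hasCorank_unique GreenbergFullAtSelmer.hasCorank_characterModule h,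
    fun h ↦ h ▸ GreenbergFullAtSelmer.hasCorank_characterModule⟩

/-- **Coranks agree along a surjection with `c`-torsion kernel** (`c ≠ 0` in the domain `Λ`).
[cite: Greenberg2006, §2 A p. 348 L4–9] [cite: Greenberg2016Selmer, §2.3 p. 7 L5–13] -/
theorem hasCorank_iff_of_surjective (π : A →ₗ[Λ] B) (hπ : Function.Surjective π)
    {c : Λ} (hc : c ≠ 0) (hker : ∀ x ∈ LinearMap.ker π, c • x = 0) (r : ℕ) :
    HasCorank Λ A r ↔ HasCorank Λ B r := by
  rw [hasCorank_iff_finrank_characterModule, hasCorank_iff_finrank_characterModule,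
    finrank_characterModule_eq_of_surjective π hπ hc hker]

/-- **Coranks agree along an injection with `c`-torsion cokernel** (`c ≠ 0` in the domain `Λ`).
[cite: Greenberg2006, §2 A p. 348 L4–9] [cite: Greenberg2016Selmer, §2.3 p. 7 L5–13] -/
theorem hasCorank_iff_of_injective (ι : B →ₗ[Λ] A) (hι : Function.Injective ι)
    {c : Λ} (hc : c ≠ 0) (hrange : ∀ a : A, c • a ∈ LinearMap.range ι) (r : ℕ) :
    HasCorank Λ A r ↔ HasCorank Λ B r := by
  rw [hasCorank_iff_finrank_characterModule, hasCorank_iff_finrank_characterModule,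
    finrank_characterModule_eq_of_injective ι hι hc hrange]

end Algebra

/-! ## §2 Greenberg's arena: `c • 𝓛 ⊆ 𝓛' ⊆ 𝓛` on `Σ` ⟹ CRK(𝐃, 𝓛) ⟺ CRK(𝐃, 𝓛') -/

section Selmer

variable {K : Type u} [Field K] [NumberField K] {S : Set (HeightOneSpectrum (𝓞 K))}
  {Λ : Type u} [CommRing Λ] [IsDomain Λ] [TopologicalSpace Λ]
  {D : Type u} [AddCommGroup D] [Module Λ D] [TopologicalSpace D] [DiscreteTopology D]
  [ContinuousSMul Λ D] {ρ : ContinuousRep (GaloisGroupUnramifiedOutside K S) Λ D}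

/-- **`finrank S_𝓛(K, 𝐃)^∨ = finrank S_{𝓛'}(K, 𝐃)^∨`**: `S_{𝓛'} ↪ S_𝓛` (part 1 `selmer_mono`) with
`c • S_𝓛 ⊆ S_{𝓛'}` (part 1 `smul_mem_selmer_of_forall`).
[cite: Greenberg2016Selmer, §2.3 p. 7 L5–13, Remark 3.1.2] [cite: Greenberg2006, §2 A p. 348 L4–9] -/
theorem finrank_characterModule_selmer_eq_of_core {L' L : Specification S ρ}
    (hle : ∀ v : Place K, InSigma S v → L' v ≤ L v) {c : Λ} (hc : c ≠ 0)
    (hr : ∀ v : Place K, InSigma S v → ∀ x ∈ L v, c • x ∈ L' v) :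
    Module.finrank Λ (CharacterModule ↥L.selmer) = Module.finrank Λ (CharacterModule ↥L'.selmer) :=
  finrank_characterModule_eq_of_injective
    (Submodule.inclusion (TelescopeK2PurityTolerantOfCore.selmer_mono hle))
    (Submodule.inclusion_injective _) hc fun x ↦
      ⟨⟨c • (x : ρ.H 1), TelescopeK2PurityTolerantOfCore.smul_mem_selmer_of_forall c hr _ x.2⟩, rfl⟩

/-- **`finrank Q_𝓛(K, 𝐃)^∨ = finrank Q_{𝓛'}(K, 𝐃)^∨`**: the componentwise projection
`Q_{𝓛'}(K, 𝐃) = ∏_{v ∈ Σ} H¹(K_v, 𝐃)/𝓛'_v ↠ ∏_{v ∈ Σ} H¹(K_v, 𝐃)/𝓛_v = Q_𝓛(K, 𝐃)` is onto with kernel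
`∏ 𝓛_v/𝓛'_v`, killed by `c`. [cite: Greenberg2016Selmer, §1 p. 3 L23–28, §2.3 p. 7 L5–13] [cite: Greenberg2006, §2 A p. 348 L4–9] -/
theorem finrank_characterModule_QGlobal_eq_of_core {L' L : Specification S ρ}
    (hle : ∀ v : Place K, InSigma S v → L' v ≤ L v) {c : Λ} (hc : c ≠ 0)
    (hr : ∀ v : Place K, InSigma S v → ∀ x ∈ L v, c • x ∈ L' v) :
    Module.finrank Λ (CharacterModule L.QGlobal) = Module.finrank Λ (CharacterModule L'.QGlobal) := by
  -- the componentwise projection `Q_{𝓛'} ↠ Q_𝓛`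
  let π : L'.QGlobal →ₗ[Λ] L.QGlobal :=
    LinearMap.pi fun v : SigmaPlace S ↦ Submodule.factor (hle v.1 v.2) ∘ₗ LinearMap.proj v
  have hπv : ∀ (q : L'.QGlobal) (v : SigmaPlace S), π q v = Submodule.factor (hle v.1 v.2) (q v) :=
    fun q v ↦ rfl
  have hπ : Function.Surjective π := by
    intro y
    have hy : ∀ v : SigmaPlace S, ∃ z : (localRep S ρ v.1).H 1, Submodule.Quotient.mk z = y v :=
      fun v ↦ Submodule.Quotient.mk_surjective _ (y v)
    choose z hz using hy
    refine ⟨fun v ↦ Submodule.Quotient.mk (z v), funext fun v ↦ ?_⟩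
    rw [hπv, ← Submodule.mkQ_apply, Submodule.factor_mk, Submodule.mkQ_apply, hz]
  have hker : ∀ q ∈ LinearMap.ker π, c • q = 0 := by
    intro q hq
    funext v
    obtain ⟨z, hz⟩ := Submodule.Quotient.mk_surjective (L' v.1) (q v)
    have hv : π q v = 0 := by rw [LinearMap.mem_ker.mp hq]; rfl
    rw [hπv, ← hz, ← Submodule.mkQ_apply, Submodule.factor_mk, Submodule.mkQ_apply,
      Submodule.Quotient.mk_eq_zero] at hv
    rw [Pi.smul_apply, ← hz, ← Submodule.Quotient.mk_smul, Pi.zero_apply,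
      Submodule.Quotient.mk_eq_zero]
    exact hr v.1 v.2 z hv
  exact (finrank_characterModule_eq_of_surjective π hπ hc hker).symm

/-- Corank transfer for the Selmer groups: `corank S_𝓛 = s ↔ corank S_{𝓛'} = s`.
[cite: Greenberg2016Selmer, §2.3 p. 7 L5–13, Remark 3.1.2] -/
theorem hasCorank_selmer_iff_of_core {L' L : Specification S ρ}
    (hle : ∀ v : Place K, InSigma S v → L' v ≤ L v) {c : Λ} (hc : c ≠ 0)
    (hr : ∀ v : Place K, InSigma S v → ∀ x ∈ L v, c • x ∈ L' v) (s : ℕ) :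
    HasCorank Λ ↥L.selmer s ↔ HasCorank Λ ↥L'.selmer s := by
  rw [hasCorank_iff_finrank_characterModule, hasCorank_iff_finrank_characterModule,
    finrank_characterModule_selmer_eq_of_core hle hc hr]

/-- Corank transfer for the targets: `corank Q_𝓛(K, 𝐃) = q ↔ corank Q_{𝓛'}(K, 𝐃) = q`.
[cite: Greenberg2016Selmer, §2.3 p. 7 L5–13] -/
theorem hasCorank_QGlobal_iff_of_core {L' L : Specification S ρ}
    (hle : ∀ v : Place K, InSigma S v → L' v ≤ L v) {c : Λ} (hc : c ≠ 0)
    (hr : ∀ v : Place K, InSigma S v → ∀ x ∈ L v, c • x ∈ L' v) (q : ℕ) :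
    HasCorank Λ L.QGlobal q ↔ HasCorank Λ L'.QGlobal q := by
  rw [hasCorank_iff_finrank_characterModule, hasCorank_iff_finrank_characterModule,
    finrank_characterModule_QGlobal_eq_of_core hle hc hr]

/-- **Route G′, input (iii′)-CRK: CRK(𝐃, 𝓛) ⟺ CRK(𝐃, 𝓛') for a `c`-isogenous core specification**
(`𝓛' ≤ 𝓛` and `c • 𝓛 ⊆ 𝓛'` on `Σ`, `c ≠ 0` in the domain `Λ`): the three coranks `h, s, q` of
`H¹(K_Σ/K, 𝐃)`, `S_𝓛`, `Q_𝓛` equal those of `H¹(K_Σ/K, 𝐃)`, `S_{𝓛'}`, `Q_{𝓛'}`.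
[cite: Greenberg2016Selmer, §2.3 p. 7 L5–17 (CRK), Remark 3.1.2, §4.2 p. 19 L25–31] [cite: Greenberg2006, §2 A p. 348 L4–9] -/
theorem crk_iff_of_core {L' L : Specification S ρ}
    (hle : ∀ v : Place K, InSigma S v → L' v ≤ L v) {c : Λ} (hc : c ≠ 0)
    (hr : ∀ v : Place K, InSigma S v → ∀ x ∈ L v, c • x ∈ L' v) : L.CRK ↔ L'.CRK := by
  constructor
  · intro h h₁ s q hh hs hq
    exact h h₁ s q hh ((hasCorank_selmer_iff_of_core hle hc hr s).2 hs)
      ((hasCorank_QGlobal_iff_of_core hle hc hr q).2 hq)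
  · intro h h₁ s q hh hs hq
    exact h h₁ s q hh ((hasCorank_selmer_iff_of_core hle hc hr s).1 hs)
      ((hasCorank_QGlobal_iff_of_core hle hc hr q).1 hq)

/-- The `c ^ a` shape of parts 1–2 (`c = p`, the `p^a`-cores): **CRK(𝐃, 𝓛) ⟹ CRK(𝐃, 𝓛')**.
[cite: Greenberg2016Selmer, §2.3 p. 7 L5–17, Prop. 4.1.1 (c), Remark 3.1.2] -/
theorem crk_of_core_pow {L' L : Specification S ρ}
    (hle : ∀ v : Place K, InSigma S v → L' v ≤ L v) {c : Λ} (hc : c ≠ 0) (a : ℕ)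
    (hr : ∀ v : Place K, InSigma S v → ∀ x ∈ L v, c ^ a • x ∈ L' v) (h : L.CRK) : L'.CRK :=
  (crk_iff_of_core hle (pow_ne_zero a hc) hr).1 h

end Selmer

end Summit.BirchSwinnertonDyer.BirchSwinnertonDyer.Theorems.TelescopeK2CoreCRKTransfer

end
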